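import Literature.Geometry.Riemannian.CalabiStrongMaximumPrinciple
import Literature.Geometry.Riemannian.AbreschGromollExcess
import HarnessLib

/-!
# Laplacian comparison for the squared distance in the barrier sense

Cheeger–Colding 1996, §1 / Petersen 2016, §5.7 (and the model computation
`Δ ρ² = 2 + 2ρ Δρ`): on a connected Riemannian `m`-manifold with complete Levi-Civita
connection, at EVERY point `x ≠ p` (cut locus included) the function `ρ² = d(p, ·)²` admits,
for every `ε > 0`, a `C²` upper barrier `φ` at `x` with
* `Δφ(x) ≤ 2m + ε` if `Ric ≥ 0` (the classical `Δ ρ² ≤ 2m` in the barrier sense), and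
* `Δφ(x) ≤ 2 + 2ρ (m-1) coth ρ + ε` if `Ric ≥ -(m-1)`.
The barriers are `(δ + d_q)²` for Calabi's auxiliary points `q`
(`exists_smooth_upper_barrier_edist[_of_ricci_nonneg]`), their Laplacians computed by the chain
rule and the eikonal equation. We PROVE both. No definitions, no named facts (D-0026).
Groundwork for `CheegerColding1997_sphereStability`.

## References

* J. Cheeger, T. H. Colding, Ann. of Math. 144 (1996) 189–237, §1. [CheegerColding1996]
* E. Calabi, Duke Math. J. 25 (1958) 45–56. [Calabi1958]
* P. Petersen, *Riemannian Geometry*, 3rd ed. (2016), §5.7, Lemma 7.1.9. [Petersen2016]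
-/

noncomputable section

open Bundle Set Function Filter
open scoped Manifold ContDiff Topology ENNReal NNReal Real

namespace Literature.Geometry.Riemannian

open Lorentzian Lorentzian.PseudoRiemannianMetric

variable {E : Type*} [NormedAddCommGroup E] [NormedSpace ℝ E] [FiniteDimensional ℝ E]
  [CompleteSpace E] {M : Type*} [TopologicalSpace M] [ChartedSpace E M] [IsManifold 𝓘(ℝ, E) ∞ M]
  [T2Space M]
  (g : PseudoRiemannianMetric 𝓘(ℝ, E) ∞ E (TangentSpace 𝓘(ℝ, E) : M → Type _)) [g.HasLeviCivita]
  [CovariantDerivative.ContMDiffCovariantDerivative g.leviCivita 1]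
  [CovariantDerivative.ContMDiffCovariantDerivative g.leviCivita ∞]

/-- **The Laplacian of `(δ + d_q)²` at a point where `d_q` is smooth**:
`Δ (δ + d_q)²(x) = 2 + 2(δ + d_q(x)) Δ d_q(x)` (chain rule and `|∇ d_q|² = 1`). [folklore] -/
theorem laplaceBeltrami_sq_const_add_edist [ConnectedSpace M] (hg : g.IsRiemannian)
    (hc : IsGeodesicallyComplete g.leviCivita) {q x : M} (hxq : x ≠ q) (δ : ℝ)
    (hsmooth : ContMDiffAt 𝓘(ℝ, E) 𝓘(ℝ, ℝ) ∞ (fun z ↦ (g.edist hg q z).toReal) x) :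
    g.laplaceBeltrami (fun z ↦ (δ + (g.edist hg q z).toReal) ^ 2) x =
      2 + 2 * (δ + (g.edist hg q x).toReal) * g.laplaceBeltrami (fun z ↦ (g.edist hg q z).toReal) x := by
  have hsm2 : ContMDiffAt 𝓘(ℝ, E) 𝓘(ℝ, ℝ) 2 (fun z ↦ (g.edist hg q z).toReal) x :=
    hsmooth.of_le (WithTop.coe_le_coe.2 le_top)
  have heik := gradSq_edist_eq_one_of_mdifferentiableAt g hg hc hxq
    (hsmooth.mdifferentiableAt (by simp))
  rw [PseudoRiemannianMetric.gradSq] at heik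
  set ζ : ℝ → ℝ := fun t ↦ (δ + t) ^ 2 with hζ
  have hζd : ∀ t, HasDerivAt ζ (2 * (δ + t)) t := fun t ↦ by
    have h := ((hasDerivAt_id t).const_add δ).pow 2
    exact h.congr_deriv (by norm_num)
  have hζ' : deriv ζ = fun t ↦ 2 * (δ + t) := funext fun t ↦ (hζd t).deriv
  have hζ'' : ∀ t, deriv (deriv ζ) t = 2 := fun t ↦ by
    rw [hζ']
    have h : HasDerivAt (fun t : ℝ ↦ 2 * (δ + t)) (2 * 1) t :=
      ((hasDerivAt_id t).const_add δ).const_mul 2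
    rw [h.deriv, mul_one]
  have hζs : ContDiff ℝ ∞ ζ := by rw [hζ]; fun_prop
  rw [laplaceBeltrami_eq_dalembertian, laplaceBeltrami_eq_dalembertian,
    show (fun z ↦ (δ + (g.edist hg q z).toReal) ^ 2) = ζ ∘ fun z ↦ (g.edist hg q z).toReal from rfl,
    g.dalembertian_real_comp hsm2 (hζs.contDiffAt.of_le (WithTop.coe_le_coe.2 le_top)), heik,
    mul_one, hζ'', hζ']

/-- **`Δ d_p² ≤ 2 + 2 d_p (m-1) coth d_p` in the barrier sense, at every `x ≠ p`**, under
`Ric ≥ -(m-1)` (Cheeger–Colding 1996, §1; barriers `(δ + d_q)²` at Calabi's points `q`).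
[cite: CheegerColding1996, §1] [cite: Calabi1958, Thm. 1] -/
theorem upper_barriers_edist_sq [ConnectedSpace M] (hg : g.IsRiemannian)
    (hc : IsGeodesicallyComplete g.leviCivita)
    (hRic : ∀ (x : M) (w : TangentSpace 𝓘(ℝ, E) x),
      -((Module.finrank ℝ E : ℝ) - 1) * g.val x w w ≤ g.leviCivita.ricci x w w)
    {p x : M} (hxp : x ≠ p) :
    ∀ ε > 0, ∃ φ : M → ℝ, (∀ᶠ x' in 𝓝 x, ContMDiffAt 𝓘(ℝ, E) 𝓘(ℝ, ℝ) 2 φ x') ∧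
      IsLocalMax (fun x' ↦ (g.edist hg p x').toReal ^ 2 - φ x') x ∧
        g.laplaceBeltrami φ x ≤ 2 + 2 * (g.edist hg p x).toReal * (((Module.finrank ℝ E : ℝ) - 1) *
          (Real.cosh (g.edist hg p x).toReal / Real.sinh (g.edist hg p x).toReal)) + ε := by
  intro ε hε
  haveI : LocallyCompactSpace M := Manifold.locallyCompact_of_finiteDimensional 𝓘(ℝ, E)
  haveI : RegularSpace M := inferInstance
  set d : ℝ := (g.edist hg p x).toReal with hd_def
  have hd0 : 0 < d := by
    rcases (ENNReal.toReal_nonneg : 0 ≤ d).eq_or_lt with h | h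
    · exfalso
      have h0 : g.edist hg p x = 0 := by
        rw [← ENNReal.ofReal_toReal (edist_ne_top hg p x)]
        exact ENNReal.ofReal_eq_zero.2 h.symm.le
      exact hxp ((g.edist_eq_zero_iff hg).1 h0).symm
    · exact h
  -- the dimension factor
  have hm : (0 : ℝ) ≤ (Module.finrank ℝ E : ℝ) - 1 := by
    obtain ⟨u₀, -, hu₀, -, -, -⟩ := exists_unit_speed_expMap_eq_of_ne g hg hc hxp
    have hu₀0 : (u₀ : E) ≠ 0 := fun h ↦ by rw [h, map_zero] at hu₀; exact zero_ne_one hu₀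
    have h1 : 0 < Module.finrank ℝ E := Module.finrank_pos_iff_exists_ne_zero.2 ⟨u₀, hu₀0⟩
    have : (1 : ℝ) ≤ (Module.finrank ℝ E : ℝ) := by exact_mod_cast h1
    linarith
  -- continuity of `coth`: choose `δ`
  obtain ⟨δ, hδ0, hδd, hcoth⟩ := exists_coth_sub_le hd0
    (show 0 < ε / (2 * d * (((Module.finrank ℝ E : ℝ) - 1) + 1)) by positivity)
  obtain ⟨q, -, hqx, htri, hsmooth, hΔ⟩ :=
    exists_smooth_upper_barrier_edist g hg hc hRic hxp hδ0 (by rw [← hd_def]; exact hδd)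
  rw [← hd_def] at hqx hΔ
  have ht₀ : (g.edist hg q x).toReal = d - δ := by rw [hqx, ENNReal.toReal_ofReal (by linarith)]
  have hxq : x ≠ q := by
    intro h; rw [h, PseudoRiemannianMetric.edist_self, ENNReal.toReal_zero] at ht₀; linarith
  refine ⟨fun z ↦ (δ + (g.edist hg q z).toReal) ^ 2, ?_, ?_, ?_⟩
  · filter_upwards [eventually_contMDiffAt_two_of_contMDiffAt hsmooth] with x' hx'
    exact (contMDiffAt_const.add hx').pow 2
  · refine Eventually.of_forall fun z ↦ ?_
    have h1 : (g.edist hg p z).toReal ≤ δ + (g.edist hg q z).toReal := by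
      have h2 := ENNReal.toReal_mono (ENNReal.add_ne_top.2 ⟨ENNReal.ofReal_ne_top, edist_ne_top hg q z⟩)
        (htri z)
      rwa [ENNReal.toReal_add ENNReal.ofReal_ne_top (edist_ne_top hg q z), ENNReal.toReal_ofReal hδ0.le] at h2
    have h3 : (g.edist hg p z).toReal ^ 2 ≤ (δ + (g.edist hg q z).toReal) ^ 2 :=
      pow_le_pow_left₀ ENNReal.toReal_nonneg h1 2
    have h4 : (g.edist hg p x).toReal ^ 2 = (δ + (g.edist hg q x).toReal) ^ 2 := by
      rw [ht₀, ← hd_def]; ring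
    show (g.edist hg p z).toReal ^ 2 - (δ + (g.edist hg q z).toReal) ^ 2 ≤
      (g.edist hg p x).toReal ^ 2 - (δ + (g.edist hg q x).toReal) ^ 2
    rw [h4, sub_self]; linarith
  · rw [laplaceBeltrami_sq_const_add_edist g hg hc hxq δ hsmooth, ht₀, show δ + (d - δ) = d by ring]
    set L := g.laplaceBeltrami (fun z ↦ (g.edist hg q z).toReal) x with hL
    set m1 : ℝ := (Module.finrank ℝ E : ℝ) - 1 with hm1
    set η : ℝ := ε / (2 * d * (m1 + 1)) with hη
    have h1 : L ≤ m1 * (Real.cosh d / Real.sinh d + η) := hΔ.trans (mul_le_mul_of_nonneg_left hcoth hm)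
    have h2 : 2 * d * (m1 * η) ≤ ε := by
      have h3 : 2 * d * (m1 * η) = ε * (m1 / (m1 + 1)) := by
        rw [hη]; field_simp
      rw [h3]
      have h4 : m1 / (m1 + 1) ≤ 1 := (div_le_one (by linarith)).2 (by linarith)
      calc ε * (m1 / (m1 + 1)) ≤ ε * 1 := mul_le_mul_of_nonneg_left h4 hε.le
        _ = ε := mul_one ε
    have h5 := mul_le_mul_of_nonneg_left h1 (show (0 : ℝ) ≤ 2 * d by linarith)
    nlinarith


/-- **`Δ d_p² ≤ 2m` in the barrier sense, at every `x ≠ p`, under `Ric ≥ 0`**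
(Cheeger–Colding 1996, §1; Petersen 2016, Lemma 7.1.9: the model value `Δ ρ² = 2m` in `ℝᵐ`):
for every `ε > 0` a `C²` upper barrier of `d_p²` at `x` with `Δ ≤ 2m + ε`.
[cite: CheegerColding1996, §1] [cite: Calabi1958, Thm. 1] -/
theorem upper_barriers_edist_sq_of_ricci_nonneg [ConnectedSpace M] (hg : g.IsRiemannian)
    (hc : IsGeodesicallyComplete g.leviCivita)
    (hRic : ∀ (x : M) (w : TangentSpace 𝓘(ℝ, E) x), 0 ≤ g.leviCivita.ricci x w w)
    {p x : M} (hxp : x ≠ p) :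
    ∀ ε > 0, ∃ φ : M → ℝ, (∀ᶠ x' in 𝓝 x, ContMDiffAt 𝓘(ℝ, E) 𝓘(ℝ, ℝ) 2 φ x') ∧
      IsLocalMax (fun x' ↦ (g.edist hg p x').toReal ^ 2 - φ x') x ∧
        g.laplaceBeltrami φ x ≤ 2 * (Module.finrank ℝ E : ℝ) + ε := by
  intro ε hε
  haveI : LocallyCompactSpace M := Manifold.locallyCompact_of_finiteDimensional 𝓘(ℝ, E)
  haveI : RegularSpace M := inferInstance
  set d : ℝ := (g.edist hg p x).toReal with hd_def
  have hd0 : 0 < d := by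
    rcases (ENNReal.toReal_nonneg : 0 ≤ d).eq_or_lt with h | h
    · exfalso
      have h0 : g.edist hg p x = 0 := by
        rw [← ENNReal.ofReal_toReal (edist_ne_top hg p x)]
        exact ENNReal.ofReal_eq_zero.2 h.symm.le
      exact hxp ((g.edist_eq_zero_iff hg).1 h0).symm
    · exact h
  have hm : (0 : ℝ) ≤ (Module.finrank ℝ E : ℝ) - 1 := by
    obtain ⟨u₀, -, hu₀, -, -, -⟩ := exists_unit_speed_expMap_eq_of_ne g hg hc hxp
    have hu₀0 : (u₀ : E) ≠ 0 := fun h ↦ by rw [h, map_zero] at hu₀; exact zero_ne_one hu₀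
    have h1 : 0 < Module.finrank ℝ E := Module.finrank_pos_iff_exists_ne_zero.2 ⟨u₀, hu₀0⟩
    have : (1 : ℝ) ≤ (Module.finrank ℝ E : ℝ) := by exact_mod_cast h1
    linarith
  set m1 : ℝ := (Module.finrank ℝ E : ℝ) - 1 with hm1
  obtain ⟨δ, hδ0, hδd, hinv⟩ := exists_inv_sub_le hd0
    (show 0 < ε / (2 * d * (m1 + 1)) by positivity)
  obtain ⟨q, -, hqx, htri, hsmooth, hΔ⟩ :=
    exists_smooth_upper_barrier_edist_of_ricci_nonneg g hg hc hRic hxp hδ0 (by rw [← hd_def]; exact hδd)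
  rw [← hd_def] at hqx hΔ
  have ht₀ : (g.edist hg q x).toReal = d - δ := by rw [hqx, ENNReal.toReal_ofReal (by linarith)]
  have hxq : x ≠ q := by
    intro h; rw [h, PseudoRiemannianMetric.edist_self, ENNReal.toReal_zero] at ht₀; linarith
  refine ⟨fun z ↦ (δ + (g.edist hg q z).toReal) ^ 2, ?_, ?_, ?_⟩
  · filter_upwards [eventually_contMDiffAt_two_of_contMDiffAt hsmooth] with x' hx'
    exact (contMDiffAt_const.add hx').pow 2
  · refine Eventually.of_forall fun z ↦ ?_
    have h1 : (g.edist hg p z).toReal ≤ δ + (g.edist hg q z).toReal := by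
      have h2 := ENNReal.toReal_mono (ENNReal.add_ne_top.2 ⟨ENNReal.ofReal_ne_top, edist_ne_top hg q z⟩)
        (htri z)
      rwa [ENNReal.toReal_add ENNReal.ofReal_ne_top (edist_ne_top hg q z), ENNReal.toReal_ofReal hδ0.le] at h2
    have h3 : (g.edist hg p z).toReal ^ 2 ≤ (δ + (g.edist hg q z).toReal) ^ 2 :=
      pow_le_pow_left₀ ENNReal.toReal_nonneg h1 2
    have h4 : (g.edist hg p x).toReal ^ 2 = (δ + (g.edist hg q x).toReal) ^ 2 := by
      rw [ht₀, ← hd_def]; ring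
    show (g.edist hg p z).toReal ^ 2 - (δ + (g.edist hg q z).toReal) ^ 2 ≤
      (g.edist hg p x).toReal ^ 2 - (δ + (g.edist hg q x).toReal) ^ 2
    rw [h4, sub_self]; linarith
  · rw [laplaceBeltrami_sq_const_add_edist g hg hc hxq δ hsmooth, ht₀, show δ + (d - δ) = d by ring]
    set L := g.laplaceBeltrami (fun z ↦ (g.edist hg q z).toReal) x with hL
    set η : ℝ := ε / (2 * d * (m1 + 1)) with hη
    have h1 : L ≤ m1 * (1 / d + η) := hΔ.trans (mul_le_mul_of_nonneg_left hinv hm)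
    have h2 : 2 * d * (m1 * η) ≤ ε := by
      have h3 : 2 * d * (m1 * η) = ε * (m1 / (m1 + 1)) := by
        rw [hη]; field_simp
      rw [h3]
      have h4 : m1 / (m1 + 1) ≤ 1 := (div_le_one (by linarith)).2 (by linarith)
      calc ε * (m1 / (m1 + 1)) ≤ ε * 1 := mul_le_mul_of_nonneg_left h4 hε.le
        _ = ε := mul_one ε
    have h5 := mul_le_mul_of_nonneg_left h1 (show (0 : ℝ) ≤ 2 * d by linarith)
    have h6 : 2 * d * (m1 * (1 / d + η)) = 2 * m1 + 2 * d * (m1 * η) := by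
      field_simp
    have h7 : (Module.finrank ℝ E : ℝ) = m1 + 1 := by rw [hm1]; ring
    rw [h7]
    nlinarith

end Literature.Geometry.Riemannian

end
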